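import Literature.IUT.LogVolume.GenuineLogThetaPoint
import Literature.IUT.LogVolume.Theorem110TowerArith
import HarnessLib

/-!
# [IUTchIV] Thm. 1.10 Steps (ii)–(iii), tower arithmetic AT A GENUINE Θ-VOLUME DATUM: from a hull estimate in the
# K-level Step (v) currency to the route-level `Cor22.HullVolumeAtDatum P l (B_III P l)` (S-b glue, datum level)

Mochizuki, *Inter-universal Teichmüller theory IV*, RIMS manuscript (Apr. 2020; = PRIMS **57** (2021)), Thm. 1.10
proof Step (iii) pp. 25–26 (final display), Step (v) p. 29; `e_mod ≤ d_mod` p. 22. TAKES NO SIDE on [IUTchIII] Cor. 3.12.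

The layer-2 skeleton of the crux `ThetaPartII` (stmt-ABC-19678, v1.2, abc-iut-plan 2026-08-26T02:24:55Z) has the
log-volume stub `stub_hullVolume : … → Cor22.HullVolumeAtDatum P l (B_III P l)` with the print-verbatim constant

  `B_III(P,l) = (l+1)/4·{(1 + 12·d_mod/l)·(log-diff + log 𝔣^{∤{2,l}}) + 2·log l + 52 + (20/3)·log(d*·l)·π(d*·l)}`.

Its support plan: S-a (abc-iut-c312-d1, `LDHGenuineStepVSum.hullEstimateOf_ofInput_explicit`) proves, for a genuine
input `I` in the slot-constant regime, `I.HullEstimateOf ((l+1)/4·{(1 + 4/l)·A + (4/l)·B + (20/3)·l*_mod·C})` with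
`A =` the `T(I)`-restricted K-different sum, `B = Σ_{p ∈ T(I)} log p`, `C = #{p ∈ T(I) : p ≤ e*_mod·l}`,
`l*_mod = log(e*_mod·l)`; S-b (abc-iut-S3) turns this into the stub's constant via the TOWER ARITHMETIC of Steps
(ii)–(iii): `A ≤ log 𝔡^{F_tpd} + log 𝔣^{F_tpd} + log(2^11·3^3·5^2) + 2·log l` (ii-K; abc-iut-S-d1 / L5-t15 instance
forms), `B ≤ 2·d_mod·(log 𝔡^{F_tpd} + log 𝔣^{F_tpd}) + log(2·3·5·l)` (iii; L5-t15 `sum_log_distinguished_le…`),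
`C ≤ π(e*_mod·l)` (a set of primes `≤ N` has at most `π(N)` members — proved here) and `e_mod ≤ d_mod`
(abc-iut-S1 `Cor22.ramificationIdx_le_dmod`).

THIS FILE (the datum-level half of S-b; the number-free half is `Theorem110TowerArith.lean`):
* `Cor22.card_filter_le_primeCounting` — `#{p ∈ s : p ≤ N} ≤ π(N)` for a finite set `s` of primes (`log(𝔰^≤) ≤ π(e*_mod·l)`);
* `Cor22.ThetaVolumeDatumAt.hullEstimateOf_mono` — monotonicity of the datum's hull estimate in the constant;
* `Cor22.ThetaVolumeDatumAt.hullEstimateOf_BIII_of_bounds` — for a genuine datum `T` at `(P, l)` (`l ≥ 5` prime),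
  `1 ≤ e_mod ≤ d_mod`, reals `A, B, C ≥ 0` with (ii-K), (iii), `C ≤ π(e*_mod·l)`:
  `T.HullEstimateOf ((l+1)/4·{(1+4/l)·A + (4/l)·B + (20/3)·log(e*_mod·l)·C}) → T.HullEstimateOf (B_III P l)`
  (exact bytes of the registered constant; `log(e*_mod·l)` in the `((2^12·3^3·5·e_mod : ℕ) : ℝ)·l` spelling of
  abc-iut-S1's `R4_localFieldFamily` / abc-iut-c312-d1's `lmod`);
* `Cor22.hullVolumeAtDatum_BIII_of_forall` — the `∀ T` form: `Cor22.HullVolumeAtDatum P l (B_III P l)` from the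
  K-level hull estimate and the three bounds at every datum.

[cite: Mochizuki2012, IUTchIV Thm. 1.10 proof Step (iii) p. 26] [cite: Mochizuki2012, IUTchIV Thm. 1.10 proof Step (v)
p. 29] [claim: Mochizuki2012, status: disputed] for every IUT quotation. Classical bookkeeping: every bound is a
hypothesis here; nothing is asserted about any curve and nothing bears on Cor. 3.12.
-/

noncomputable section

namespace Literature.IUT.LogVolume

namespace Cor22

open NumberField IsDedekindDomain
open Literature.NumberTheory.DiophantineGeometry.GenEll
open scoped Nat.Prime

/-! ## `log(𝔰^≤) ≤ π(e*_mod·l)` -/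

/-- A finite set of primes has at most `π(N)` members `≤ N` ("`log(𝔰^≤) = Σ_{w_ℚ ∈ 𝕍^dst_ℚ, p_{w_ℚ} ≤ e*_mod·l} 1
≤ Σ_{p ≤ e*_mod·l} 1`", Step (iii) p. 25 / Step (viii) p. 30). [cite: Mochizuki2012, IUTchIV Thm. 1.10 proof Step (iii) p. 25] -/
theorem card_filter_le_primeCounting (s : Finset ℕ) (hs : ∀ p ∈ s, p.Prime) (N : ℕ) :
    (s.filter (· ≤ N)).card ≤ π N := by
  classical
  rw [Nat.primeCounting, Nat.primeCounting', Nat.count_eq_card_filter_range]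
  refine Finset.card_le_card fun p hp => ?_
  obtain ⟨hps, hpN⟩ := Finset.mem_filter.mp hp
  exact Finset.mem_filter.mpr ⟨Finset.mem_range.mpr (Nat.lt_succ_of_le hpN), hs p hps⟩

/-! ## At the datum -/

namespace ThetaVolumeDatumAt

variable {P : NFPoint} {l : ℕ} (T : ThetaVolumeDatumAt P l)

/-- The datum's hull estimate is monotone in the constant. [cite: DupuyHilado2025, §4.12] -/
theorem hullEstimateOf_mono {δ δ' : ℝ} (h : T.HullEstimateOf δ) (hle : δ ≤ δ') : T.HullEstimateOf δ' := by
  letI := T.instFieldF; letI := T.instNumberFieldF; letI := T.instFieldK; letI := T.instNumberFieldK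
  letI := T.instAlgebraK
  unfold HullEstimateOf ThetaVolumeInput.HullEstimateOf at h ⊢
  exact h.trans (by linarith)

/-- **S-b at the datum: from the K-level Step (v) constant to `B_III(P, l)`.** For a genuine Θ-volume datum `T` at
`(P, l)` (`l ≥ 5` prime), `1 ≤ e_mod ≤ d_mod`, and reals `A, B, C ≥ 0` with the combined Step (ii) bound
`A ≤ log-diff + log 𝔣^{∤{2,l}} + log(2^11·3^3·5^2) + 2·log l`, the Step (iii) bound `B ≤ 2·d_mod·(log-diff + log
𝔣^{∤{2,l}}) + log(2·3·5·l)` and `C ≤ π(e*_mod·l)`: a hull estimate for `T` with the constant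
`(l+1)/4·{(1+4/l)·A + (4/l)·B + (20/3)·log(e*_mod·l)·C}` (the shape abc-iut-c312-d1's S-a produces) implies the hull
estimate with the registered `B_III(P, l)` (`Cor22.deltaK_le_BIII` + monotonicity).
[cite: Mochizuki2012, IUTchIV Thm. 1.10 proof Step (iii) p. 26] [claim: Mochizuki2012, status: disputed] -/
theorem hullEstimateOf_BIII_of_bounds (hl : l.Prime) (h5 : 5 ≤ l) {emod : ℕ} (hemod : 1 ≤ emod)
    (hemod' : emod ≤ dmod P) {A B C : ℝ} (hA : 0 ≤ A) (hB : 0 ≤ B) (hC : 0 ≤ C)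
    (hAle : A ≤ P.logDiff + logCondAvoid P {2, l} + Real.log (2 ^ 11 * 3 ^ 3 * 5 ^ 2) + 2 * Real.log l)
    (hBle : B ≤ 2 * (dmod P : ℝ) * (P.logDiff + logCondAvoid P {2, l}) + Real.log (2 * 3 * 5 * (l : ℝ)))
    (hCle : C ≤ (π (2 ^ 12 * 3 ^ 3 * 5 * emod * l) : ℝ))
    (h : T.HullEstimateOf (((l : ℝ) + 1) / 4 * ((1 + 4 / (l : ℝ)) * A + 4 / (l : ℝ) * B
      + 20 / 3 * Real.log (((2 ^ 12 * 3 ^ 3 * 5 * emod : ℕ) : ℝ) * l) * C))) :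
    T.HullEstimateOf (((l : ℝ) + 1) / 4 * ((1 + 12 * (dmod P : ℝ) / l) * (P.logDiff + logCondAvoid P {2, l})
      + 2 * Real.log l + 52 + 20 / 3 * Real.log (((2 ^ 12 * 3 ^ 3 * 5 * dmod P : ℕ) : ℝ) * (l : ℝ))
        * (Nat.primeCounting (2 ^ 12 * 3 ^ 3 * 5 * dmod P * l) : ℝ))) := by
  refine T.hullEstimateOf_mono h ?_
  have e : (((2 ^ 12 * 3 ^ 3 * 5 * emod : ℕ) : ℝ) * l) = ((2 : ℝ) ^ 12 * 3 ^ 3 * 5 * emod * l) := by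
    push_cast; ring
  rw [e]
  exact deltaK_le_BIII hl h5 hemod hemod' hA hB hC hAle hBle hCle

/-- The same with the `e_mod`-count already taken as a filtered set of primes (`C := #{p ∈ s : p ≤ e*_mod·l}` for a
finite set `s` of primes, e.g. the support primes `T(I)`), so that only (ii-K), (iii) and `e_mod ≤ d_mod` remain.
[cite: Mochizuki2012, IUTchIV Thm. 1.10 proof Step (iii) p. 25–26] [claim: Mochizuki2012, status: disputed] -/
theorem hullEstimateOf_BIII_of_bounds' (hl : l.Prime) (h5 : 5 ≤ l) {emod : ℕ} (hemod : 1 ≤ emod)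
    (hemod' : emod ≤ dmod P) {A B : ℝ} (hA : 0 ≤ A) (hB : 0 ≤ B) (s : Finset ℕ) (hs : ∀ p ∈ s, p.Prime)
    (hAle : A ≤ P.logDiff + logCondAvoid P {2, l} + Real.log (2 ^ 11 * 3 ^ 3 * 5 ^ 2) + 2 * Real.log l)
    (hBle : B ≤ 2 * (dmod P : ℝ) * (P.logDiff + logCondAvoid P {2, l}) + Real.log (2 * 3 * 5 * (l : ℝ)))
    (h : T.HullEstimateOf (((l : ℝ) + 1) / 4 * ((1 + 4 / (l : ℝ)) * A + 4 / (l : ℝ) * B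
      + 20 / 3 * Real.log (((2 ^ 12 * 3 ^ 3 * 5 * emod : ℕ) : ℝ) * l)
        * ((s.filter (· ≤ 2 ^ 12 * 3 ^ 3 * 5 * emod * l)).card : ℝ)))) :
    T.HullEstimateOf (((l : ℝ) + 1) / 4 * ((1 + 12 * (dmod P : ℝ) / l) * (P.logDiff + logCondAvoid P {2, l})
      + 2 * Real.log l + 52 + 20 / 3 * Real.log (((2 ^ 12 * 3 ^ 3 * 5 * dmod P : ℕ) : ℝ) * (l : ℝ))
        * (Nat.primeCounting (2 ^ 12 * 3 ^ 3 * 5 * dmod P * l) : ℝ))) :=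
  T.hullEstimateOf_BIII_of_bounds hl h5 hemod hemod' hA hB (Nat.cast_nonneg _) hAle hBle
    (by exact_mod_cast card_filter_le_primeCounting s hs _) h

end ThetaVolumeDatumAt

/-- **`Cor22.HullVolumeAtDatum P l (B_III P l)` from the K-level hull estimates and the tower bounds at every
datum** (the `∀ T` form of `hullEstimateOf_BIII_of_bounds`): the body of `stub_hullVolume` at `(P, l)` once S-a
(log-volume) and the instance forms of (ii-K), (iii), `e_mod ≤ d_mod` are supplied datum by datum.
[cite: Mochizuki2012, IUTchIV Thm. 1.10 proof Steps (iii), (v) p. 26, 29] [claim: Mochizuki2012, status: disputed] -/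
theorem hullVolumeAtDatum_BIII_of_forall {P : NFPoint} {l : ℕ} (hl : l.Prime) (h5 : 5 ≤ l)
    (H : ∀ T : ThetaVolumeDatumAt P l, ∃ (emod : ℕ) (A B C : ℝ),
      1 ≤ emod ∧ emod ≤ dmod P ∧ 0 ≤ A ∧ 0 ≤ B ∧ 0 ≤ C ∧
      A ≤ P.logDiff + logCondAvoid P {2, l} + Real.log (2 ^ 11 * 3 ^ 3 * 5 ^ 2) + 2 * Real.log l ∧
      B ≤ 2 * (dmod P : ℝ) * (P.logDiff + logCondAvoid P {2, l}) + Real.log (2 * 3 * 5 * (l : ℝ)) ∧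
      C ≤ (π (2 ^ 12 * 3 ^ 3 * 5 * emod * l) : ℝ) ∧
      T.HullEstimateOf (((l : ℝ) + 1) / 4 * ((1 + 4 / (l : ℝ)) * A + 4 / (l : ℝ) * B
        + 20 / 3 * Real.log (((2 ^ 12 * 3 ^ 3 * 5 * emod : ℕ) : ℝ) * l) * C))) :
    HullVolumeAtDatum P l (((l : ℝ) + 1) / 4 * ((1 + 12 * (dmod P : ℝ) / l) * (P.logDiff + logCondAvoid P {2, l})
      + 2 * Real.log l + 52 + 20 / 3 * Real.log (((2 ^ 12 * 3 ^ 3 * 5 * dmod P : ℕ) : ℝ) * (l : ℝ))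
        * (Nat.primeCounting (2 ^ 12 * 3 ^ 3 * 5 * dmod P * l) : ℝ))) := by
  intro T
  obtain ⟨emod, A, B, C, hemod, hemod', hA, hB, hC, hAle, hBle, hCle, h⟩ := H T
  exact T.hullEstimateOf_BIII_of_bounds hl h5 hemod hemod' hA hB hC hAle hBle hCle h

end Cor22

end Literature.IUT.LogVolume

end
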